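import Summits.Ventures.CertifiedManyBodySolver.Downfold.PressureAxis
import HarnessLib

/-!
# The pressure-interval word read off the hull of two parameter BOXES

Venture CertifiedManyBodySolver, cell `pub/hubbard-downfold` (S1 = downfolding front end = ROUTER),
seat hubbard-downfold-mod-2; namespaces `Summit.Ventures.CertifiedManyBodySolver.Downfold` /
`.Router`. `Downfold.PressureAxis` states the P-interval word on the hull of two SKELETONS
(`Skel.hull` = coordinatewise interval hull of the claimed enclosures). The box files of record and
`router/router.py` work with parameter BOXES (`Downfold.ParameterBox`: per coordinate an `Entry` =
base interval + declared inflation + grade), and the hull verb a tool would implement is mod-1's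
`Box.hull` (coordinatewise `Entry.hull`: hull of the bases, the LARGER inflation radius, the weaker
grade). Its skeleton is in general WIDER than the hull of the two skeletons (the larger radius is
applied to the hulled base), never narrower: `Box.skel_hull_incl`. Hence (`Row.fires_mono`) a row
that fires on the routed `Box.hull` record fires on the skeleton hull, and the interval word follows:
`Router.Row.sat_on_Icc_of_fires_hull` (skeleton form with the hull-firing hypothesis — weaker than
asking the row to fire at both ends) and `Router.Row.sat_on_Icc_of_box_hull` (**route the `Box.hull`
of the two point boxes; if a row fires there and every coordinate both boxes determine is monotone
between the points, the row's word holds at every intermediate pressure**; `router/INFLATION-RULES.md`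
§P.12(e)/(f)). Everything is PROVED. WHAT THIS IS NOT: a statement about any material; a claim that
`Box.hull` is the only admissible hull record (any record whose skeleton inflates `Skel.hull` does).
-/

open Set

namespace Summit.Ventures.CertifiedManyBodySolver.Downfold

open NonemptyInterval

variable {ι : Type*}

/-- **The routed hull record is an inflation of the skeleton hull.** For mod-1's `Box.hull`
(coordinatewise `Entry.hull`), every coordinate present in `(B.hull C).skel` is present in
`B.skel.hull C.skel` with a sub-interval: `e.encl ⊔ f.encl ≤ (e.hull f).encl`. [folklore] -/
theorem Box.skel_hull_incl (B C : Box ι) : (B.skel.hull C.skel).Incl (B.hull C).skel := by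
  intro i L hL
  unfold Box.skel at hL
  unfold Box.hull at hL
  rcases hB : B i with _ | e <;> rcases hC : C i with _ | f <;> simp [hB, hC] at hL
  subst hL
  refine ⟨e.encl ⊔ f.encl, ?_, sup_le (Entry.encl_le_hull_left e f) (Entry.encl_le_hull_right e f)⟩
  exact Skel.hull_eq_some_iff.2 ⟨e.encl, f.encl, by simp [Box.skel, hB], by simp [Box.skel, hC], rfl⟩

namespace Router

variable {ω : Type*}

/-- **P-interval word, hull-firing form.** A parameter path `p : ℝ → ι → ℝ` on `[a, b]`, the
skeleton `S₁` admitting `p a` and `S₂` admitting `p b`, every coordinate present in both monotone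
or antitone along the path, and a row FIRING ON THE HULL `S₁.hull S₂` (weaker than firing at both
ends: `Row.fires_hull`): the row holds at every `u ∈ [a, b]`. [folklore] -/
theorem Row.sat_on_Icc_of_fires_hull {r : Row ι ω} {S₁ S₂ : Skel ι} {p : ℝ → ι → ℝ} {a b : ℝ}
    (hmono : ∀ i I J, S₁ i = some I → S₂ i = some J →
      MonotoneOn (fun u => p u i) (Icc a b) ∨ AntitoneOn (fun u => p u i) (Icc a b))
    (ha : S₁.Mem (p a)) (hb : S₂.Mem (p b)) (h : r.fires (S₁.hull S₂) = true) :
    ∀ u ∈ Icc a b, r.Sat (p u) := by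
  intro u hu
  refine Row.fires_sound h (Skel.mem_hull_of_coords fun i I J hI hJ => ?_)
  refine mem_ratCast_sup_of_mem_Icc (ha i I hI) (hb i J hJ) ?_
  rcases hmono i I J hI hJ with hm | hm
  · obtain ⟨l, r⟩ := Inflation.mem_Icc_of_monotoneOn hm hu
    exact ⟨(min_le_left _ _).trans l, r.trans (le_max_right _ _)⟩
  · obtain ⟨l, r⟩ := Inflation.mem_Icc_of_antitoneOn hm hu
    exact ⟨(min_le_right _ _).trans l, r.trans (le_max_left _ _)⟩

/-- **P-interval word read off the routed `Box.hull` record** (§P.12(e)/(f)): two point boxes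
`B₁ ∋ p a`, `B₂ ∋ p b`, every coordinate determined by BOTH boxes monotone or antitone along the
path, and a row firing on the skeleton of `B₁.hull B₂` (the record a hull verb routes): the row's
word holds at every `u ∈ [a, b]`. [folklore] -/
theorem Row.sat_on_Icc_of_box_hull {r : Row ι ω} {B₁ B₂ : Box ι} {p : ℝ → ι → ℝ} {a b : ℝ}
    (hmono : ∀ i e f, B₁ i = some e → B₂ i = some f →
      MonotoneOn (fun u => p u i) (Icc a b) ∨ AntitoneOn (fun u => p u i) (Icc a b))
    (ha : B₁.Mem (p a)) (hb : B₂.Mem (p b)) (h : r.fires (B₁.hull B₂).skel = true) :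
    ∀ u ∈ Icc a b, r.Sat (p u) := by
  refine Row.sat_on_Icc_of_fires_hull (S₁ := B₁.skel) (S₂ := B₂.skel) (fun i I J hI hJ => ?_)
    ((B₁.mem_iff_skel_mem _).1 ha) ((B₂.mem_iff_skel_mem _).1 hb)
    (Row.fires_mono (Box.skel_hull_incl B₁ B₂) h)
  unfold Box.skel at hI hJ
  rcases h1 : B₁ i with _ | e
  · simp [h1] at hI
  · rcases h2 : B₂ i with _ | f
    · simp [h2] at hJ
    · exact hmono i e f h1 h2

/-- The routed word of the `Box.hull` record, when a row fires there, is a table word equal to that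
row's (consistent table) — so the interval inherits a TABLE verdict, never a silent average.
[folklore] -/
theorem route_box_hull_of_fires {T : List (Row ι ω)} (hT : Consistent T) {B₁ B₂ : Box ι}
    {r : Row ι ω} (hr : r ∈ T) (h : r.fires (B₁.hull B₂).skel = true) :
    route T (B₁.hull B₂).skel = .table r.out :=
  route_table_of_fires hT hr h

end Router

/-! ## §2 The (b)-MARGIN TEST and the one-sided GUARD TEST as decisions

`router/INFLATION-RULES.md` §P.12(b) pads an unsigned positive coordinate `X` (`U/t`, `r_man`, `r₁`,
…; `X = exp ∘ f` along `u = log V`, `|f'| ≤ S`) by `e^{± S L / 2}` on the hull of its two end boxes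
(`PressureAxis.exp_mem_Icc_interp_half`). A guard window `X < θ` (e.g. the R3c atom
`r_man < θ_c3 = 0.6`) or `θ < X` (e.g. `θ_hi ≤ r₁` for a decided «1BH») then holds on the WHOLE
sub-interval as soon as the PADDED hull clears the threshold — the arithmetic printed on every
interval row of `router/P-INTERVALS.md` («0.27 × e^(1.2·0.209) = 0.35 < 0.6» decided;
«0.50 × e^(1.2·0.307) = 0.72 ≥ 0.6» decides nothing). The one-sided forms are the guard test of
§P.12(c′)(iii)-BY-GUARD («r_man,hi · e^(2.4 ℓ) < θ_c3»). Failure of a test is NOT a theorem about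
`X`: it only withholds the word («undetermined (P-interpolation)»). -/

namespace Inflation

/-- **THE (b)-MARGIN TEST, upper guard.** `X = exp ∘ f`, `f` continuous on `[a, b]` with
`|f'| ≤ S` (`0 ≤ S`) on `(a, b)`, end values `X(a) ≤ h₁`, `X(b) ≤ h₂`, and the padded hull below
the threshold, `max h₁ h₂ · e^{S (b - a) / 2} < θ` ⇒ `X(u) < θ` at EVERY `u ∈ [a, b]`. [folklore] -/
theorem exp_lt_on_Icc_of_padded_hull_lt {f f' : ℝ → ℝ} {a b S u h₁ h₂ θ : ℝ}
    (hcont : ContinuousOn f (Icc a b)) (hder : ∀ x ∈ Ioo a b, HasDerivAt f (f' x) x)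
    (hS : ∀ x ∈ Ioo a b, |f' x| ≤ S) (hS0 : 0 ≤ S) (ha : Real.exp (f a) ≤ h₁)
    (hb : Real.exp (f b) ≤ h₂) (hθ : max h₁ h₂ * Real.exp (S * ((b - a) / 2)) < θ)
    (hu : u ∈ Icc a b) : Real.exp (f u) < θ := by
  obtain ⟨-, r⟩ := exp_mem_Icc_interp_half hcont hder hS hS0 (Real.exp_pos (f a))
    (Real.exp_pos (f b)) ⟨le_rfl, ha⟩ ⟨le_rfl, hb⟩ hu
  exact r.trans_lt hθ

/-- **THE (b)-MARGIN TEST, lower guard.** End values `l₁ ≤ X(a)`, `l₂ ≤ X(b)` with `0 < l₁`,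
`0 < l₂`, and the padded hull above the threshold, `θ < min l₁ l₂ · e^{-S (b - a) / 2}` ⇒
`θ < X(u)` at every `u ∈ [a, b]` (e.g. `θ_hi < r₁,lo · e^{-S L / 2}` keeps «1BH» decided).
[folklore] -/
theorem lt_exp_on_Icc_of_lt_padded_hull {f f' : ℝ → ℝ} {a b S u l₁ l₂ θ : ℝ}
    (hcont : ContinuousOn f (Icc a b)) (hder : ∀ x ∈ Ioo a b, HasDerivAt f (f' x) x)
    (hS : ∀ x ∈ Ioo a b, |f' x| ≤ S) (hS0 : 0 ≤ S) (hl₁ : 0 < l₁) (hl₂ : 0 < l₂)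
    (ha : l₁ ≤ Real.exp (f a)) (hb : l₂ ≤ Real.exp (f b))
    (hθ : θ < min l₁ l₂ * Real.exp (-(S * ((b - a) / 2)))) (hu : u ∈ Icc a b) :
    θ < Real.exp (f u) := by
  obtain ⟨l, -⟩ := exp_mem_Icc_interp_half hcont hder hS hS0 hl₁ hl₂ ⟨ha, le_rfl⟩ ⟨hb, le_rfl⟩ hu
  exact hθ.trans_le l

/-- **THE ONE-SIDED GUARD TEST, upper guard** (§P.12(c′)(iii)-BY-GUARD: a reach `[a, b]` beyond the
last computed point `a`): `X(a) ≤ h`, `|f'| ≤ S` (`0 ≤ S`) on `(a, b)`, and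
`h · e^{S (b - a)} < θ` ⇒ `X(u) < θ` for every `u ∈ [a, b]`. [folklore] -/
theorem exp_lt_on_Icc_of_padded_end_lt {f f' : ℝ → ℝ} {a b S u h θ : ℝ}
    (hcont : ContinuousOn f (Icc a b)) (hder : ∀ x ∈ Ioo a b, HasDerivAt f (f' x) x)
    (hS : ∀ x ∈ Ioo a b, |f' x| ≤ S) (hS0 : 0 ≤ S) (ha : Real.exp (f a) ≤ h)
    (hθ : h * Real.exp (S * (b - a)) < θ) (hu : u ∈ Icc a b) : Real.exp (f u) < θ := by
  obtain ⟨-, r⟩ := mem_Icc_of_abs_deriv_le_left hcont hder hS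
    (show f a ∈ Icc (f a) (f a) from ⟨le_rfl, le_rfl⟩) hu
  have h1 : f u ≤ f a + S * (b - a) :=
    r.trans (by linarith [mul_le_mul_of_nonneg_left (show u - a ≤ b - a by linarith [hu.2]) hS0])
  have h2 : Real.exp (f u) ≤ Real.exp (f a) * Real.exp (S * (b - a)) := by
    rw [← Real.exp_add]; exact Real.exp_le_exp.2 h1
  exact (h2.trans (mul_le_mul_of_nonneg_right ha (Real.exp_pos _).le)).trans_lt hθ

/-- **THE ONE-SIDED GUARD TEST, lower guard**: `l ≤ X(a)`, `|f'| ≤ S` on `(a, b)`, and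
`θ < l · e^{-S (b - a)}` ⇒ `θ < X(u)` for every `u ∈ [a, b]`. [folklore] -/
theorem lt_exp_on_Icc_of_lt_padded_end {f f' : ℝ → ℝ} {a b S u l θ : ℝ}
    (hcont : ContinuousOn f (Icc a b)) (hder : ∀ x ∈ Ioo a b, HasDerivAt f (f' x) x)
    (hS : ∀ x ∈ Ioo a b, |f' x| ≤ S) (hS0 : 0 ≤ S) (ha : l ≤ Real.exp (f a))
    (hθ : θ < l * Real.exp (-(S * (b - a)))) (hu : u ∈ Icc a b) : θ < Real.exp (f u) := by
  obtain ⟨r, -⟩ := mem_Icc_of_abs_deriv_le_left hcont hder hS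
    (show f a ∈ Icc (f a) (f a) from ⟨le_rfl, le_rfl⟩) hu
  have h1 : f a - S * (b - a) ≤ f u :=
    le_trans (by linarith [mul_le_mul_of_nonneg_left (show u - a ≤ b - a by linarith [hu.2]) hS0]) r
  have h2 : Real.exp (f a) * Real.exp (-(S * (b - a))) ≤ Real.exp (f u) := by
    rw [← Real.exp_add]; exact Real.exp_le_exp.2 (by linarith)
  have h3 : l * Real.exp (-(S * (b - a))) ≤ Real.exp (f a) * Real.exp (-(S * (b - a))) :=
    mul_le_mul_of_nonneg_right ha (Real.exp_pos _).le
  exact hθ.trans_le (h3.trans h2)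

end Inflation

end Summit.Ventures.CertifiedManyBodySolver.Downfold
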